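import Summits.BirchSwinnertonDyer.BirchSwinnertonDyer.Theorems.ByReductionTypeAtTwoOrdKatoHalfAtTwoIsoGreenbergMuDefs
import Summits.BirchSwinnertonDyer.BirchSwinnertonDyer.Theorems.ByReductionTypeAtTwoOrdKatoHalfAtTwoIsoHintOfAbbesUllmo
import Summits.BirchSwinnertonDyer.Rank1Residual.X5.KatoOrdTwoMuPart
import Literature.NumberTheory.EllipticCurves.IsogenyIdProofs
import HarnessLib

/-!
# Cert51a — crux-triage r1 seat 2 (GEN 51), crux `OrdKatoHalfAtTwoIso` (stmt-BirchSwinnertonDyer-19573), line `steinberg-fibre-at-two`: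
# the announced v24 stub G11⁺ READ BY NAME OF THE LANDED DECL `SteinbergFibreAtTwo.GreenbergMuZeroTwoOrdPosDisc` (p733065, 16:51Z),
# ROUTE-FILE-FREE (the K4 route-file cone and the `…PosDiscNecessity*` cone are farm-stale at 17:0xZ; this file avoids both)

HONEST FRAMING (cell bsd-2adic): BSD is not proved by any of this; crux 202 is not proved; G11⁺ (Greenberg LNM 1716 Conj. 1.11 at
`p = 2` on the cell [non-CM · r_an = 0 · good ordinary at 2 · ρ̄₂ onto · 0 < Δ]) is an OPEN published conjecture — below it is only ever a
HYPOTHESIS or one side of an `Iff.rfl`. THEOREMS + two local `def`s (texts for quoting); no `sorry`, no instance, no axiom, no Literature fact.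

What the kernel certifies here (acceptance rule §B (a′)/(b′) of TRIAGE-r1-2 GEN 49/50, now executable against a TREE decl):
* §1 `leadList_iff_landed` — the LEAD g10's 16:08Z binder list (= the type of `stub_greenbergMu_two_posDisc` in the LEAD's v24 DRAFT
  `HOME/cruxlead19573-g10/OrdKatoHalfAtTwoIso_v24_draft.lean` @40cdaff9ae9fd05d :523–527, = `Cert50a.G11pos`) **is** the landed def, by
  `Iff.rfl` — so a v24 registration typing the stub either as this text or BY NAME passes (a′) identically;
* §2 `posDiscBody_of_greenbergMu` — the DIRECT ROAD by name of the landed decl: G11⁺ + Abbes–Ullmo + Kato 17.4 (1)(2)@2 ⟹ the body of the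
  `0 < Δ` conjunct `OrdKatoHalfAtTwoIsoPosDisc` (verbatim `PosDiscBody`, `W′ := W`) through K4's LANDED doors `O1.katoMuPartAtTwo_of_mu_eq_zero`
  (hypothesis shape = G11⁺'s per-curve matrix, binder for binder) and `O1.mainConjectureLowerDivisibilityAtTwoOrd_of_katoMuPartAtTwo` with the
  line's `hint_two_of_abbesUllmo_of_irr` — the composition the v24 draft uses (`posDisc_of_greenbergMu` :536–555), GEN 50's `Cert50a` re-keyed
  from a local text to the tree decl.
The by-name NECESSITY / `Iff` / Q⁺-discharge half (doors `mu_eq_zero_of_posDisc`, `finite_fineSelmerInfty_twoTorsion_of_forall_mu_eq_zero`,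
`finite_twoTorsion_fineSelmerInfty_of_isCyclotomic`) lives in the stale `…PosDiscNecessityTwist` cone and is written separately (`Cert51b.lean`).

References: R. Greenberg, in LNM 1716 (1999), Conj. 1.11 p. 64 [GreenbergLNM1716]; K. Kato, Astérisque 295 (2004) Thm. 17.4 [Kato2004Asterisque];
A. Abbes, E. Ullmo, Compositio Math. 103 (1996) Thm. A [AbbesUllmo1996]; tree: p733065 `…OrdKatoHalfAtTwoIsoGreenbergMuDefs`, K4
`Rank1Residual/X5/KatoOrdTwoMuPart`, line `…HintOfAbbesUllmo`.
-/

set_option autoImplicit false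
set_option linter.dupNamespace false

noncomputable section

open scoped Classical MatrixGroups ModularForm

open CongruenceSubgroup WeierstrassCurve Field
  Literature.NumberTheory.GaloisRepresentations
  Literature.NumberTheory.EllipticCurves
  Literature.NumberTheory.EllipticCurves.ModularForms
  Literature.NumberTheory.EllipticCurves.Rank1Residual
  Literature.NumberTheory.EllipticCurves.SkinnerUrban2014
  Summit.BirchSwinnertonDyer.Rank1Residual.X5
open Summit.BirchSwinnertonDyer.BirchSwinnertonDyer.Theorems.SteinbergFibreAtTwo

namespace Summit.BirchSwinnertonDyer.BirchSwinnertonDyer.Cruxes.OrdKatoHalfAtTwoIso.Cert51a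

/-! ### §1 The announced stub text IS the landed decl -/

/-- [RESEARCH, OPEN — quoted, not asserted] The LEAD g10's 16:08Z binder list for the v24 stub G11⁺ (HOME INBOX l.2277; = the TYPE of
`stub_greenbergMu_two_posDisc` in the v24 draft :523–527, verbatim; = `Cert50a.G11pos`). [cite: GreenbergLNM1716, Conj. 1.11 (p. 64) (shape only)] -/
def LeadList : Prop :=
  ∀ (W : WeierstrassCurve ℚ) [W.IsElliptic] [W.IsGloballyMinimal],
      ¬ W.HasCM → W.analyticRank = 0 → GoodOrd W 2 → W.HasSurjectiveModNGaloisRep 2 → 0 < W.Δ →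
      ∀ (κ : ZpExtension ℚ 2) (γ : absoluteGaloisGroup ℚ), κ.IsCyclotomic → κ.IsTopGenerator γ →
        IsCyclotomicVariable 2 γ → ∀ D : W.SelmerDualData κ γ, D.mu = 0

/-- **(a′) in the kernel: the announced text and the LANDED decl `GreenbergMuZeroTwoOrdPosDisc` (p733065) are the same proposition, by
`Iff.rfl`.** So «inline text» and «BY NAME» registrations of the v24 stub are interchangeable for the acceptance rule. [folklore] -/
theorem leadList_iff_landed : LeadList ↔ GreenbergMuZeroTwoOrdPosDisc :=
  Iff.rfl

/-- The same identity read against the landed unfolding lemma `greenbergMuZeroTwoOrdPosDisc_iff` (its right-hand side is `LeadList`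
verbatim). [folklore] -/
theorem leadList_iff_landed' : LeadList ↔ GreenbergMuZeroTwoOrdPosDisc :=
  greenbergMuZeroTwoOrdPosDisc_iff.symm

/-! ### §2 The direct road BY NAME of the landed decl (route-file-free) -/

/-- [RESEARCH, OPEN — quoted, not asserted] The body of the `0 < Δ` conjunct `SteinbergFibreAtTwo.OrdKatoHalfAtTwoIsoPosDisc` VERBATIM
(`…OrdKatoHalfAtTwoIsoPosDiscDefs.lean` :149–153; that module's cone is farm-stale, hence the restatement — identical to `Cert50a.PosDiscBody`).
[cite: Kato2004Asterisque, Thm. 17.4 (p. 273) (shape only; nothing asserted)] -/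
def PosDiscBody : Prop :=
  ∀ (W : WeierstrassCurve ℚ) [W.IsElliptic] [W.IsGloballyMinimal], ¬ W.HasCM → W.analyticRank = 0 →
    Literature.NumberTheory.EllipticCurves.Rank1Residual.GoodOrd W 2 → W.HasSurjectiveModNGaloisRep 2 → 0 < W.Δ →
    ∃ (W' : WeierstrassCurve ℚ) (_ : W'.IsElliptic) (_ : W'.IsGloballyMinimal),
      WeierstrassCurve.IsIsogenous W W' ∧ Summit.BirchSwinnertonDyer.Rank1Residual.X5.O1.MainConjectureLowerDivisibilityAtTwoOrd W'

/-- **G11⁺ (the landed decl, as a hypothesis) ⟹ Kato's `μ`-part `O1.KatoMuPartAtTwo W` at every curve of the cell** — K4's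
`O1.katoMuPartAtTwo_of_mu_eq_zero`, whose hypothesis is G11⁺'s per-curve matrix binder for binder (= the v24 draft's `katoMuPartAtTwo_posDisc`).
CONDITIONAL on G11⁺ (OPEN); nothing closed. [cite: GreenbergLNM1716, Conj. 1.11 (p. 64) (shape of the hypothesis)] -/
theorem katoMuPartAtTwo_of_greenbergMu (hG : GreenbergMuZeroTwoOrdPosDisc) (W : WeierstrassCurve ℚ) [W.IsElliptic]
    [W.IsGloballyMinimal] (hcm : ¬ W.HasCM) (hr : W.analyticRank = 0) (hgo : GoodOrd W 2)
    (h2 : W.HasSurjectiveModNGaloisRep 2) (hΔ : 0 < W.Δ) : O1.KatoMuPartAtTwo W :=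
  O1.katoMuPartAtTwo_of_mu_eq_zero W (hG W hcm hr hgo h2 hΔ)

/-- **G11⁺ + Abbes–Ullmo + Kato 17.4 (1)(2) at `2` ⟹ `O1.MainConjectureLowerDivisibilityAtTwoOrd W` AT EVERY CURVE `W` OF THE CELL**
(not merely at an isogenous member). CONDITIONAL on G11⁺ (OPEN); nothing closed.
[cite: Kato2004Asterisque, Thm. 17.4 (1)(2) (p. 273)] [cite: AbbesUllmo1996, Thm. A] -/
theorem mainConjectureLowerDivisibilityAtTwoOrd_of_greenbergMu (hG : GreenbergMuZeroTwoOrdPosDisc)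
    (hAU : abbesUllmo_not_dvd_maninConstant_of_not_dvd_level)
    (W : WeierstrassCurve ℚ) [W.IsElliptic] [W.IsGloballyMinimal] (hcm : ¬ W.HasCM) (hr : W.analyticRank = 0) (hgo : GoodOrd W 2)
    (h2 : W.HasSurjectiveModNGaloisRep 2) (hΔ : 0 < W.Δ)
    (h17 : ∀ [NeZero (W.conductorNorm ℤ)] (f : CuspForm (Gamma0 (W.conductorNorm ℤ)) 2),
      kato_divisibility_allPrimes W 2 (f := f)) :
    O1.MainConjectureLowerDivisibilityAtTwoOrd W := by
  haveI : NeZero ((2 : ℕ) : ℚ) := ⟨by norm_num⟩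
  exact O1.mainConjectureLowerDivisibilityAtTwoOrd_of_katoMuPartAtTwo W h17
    (fun f hf ϖ hϖ => hint_two_of_abbesUllmo_of_irr hAU W hgo
      (hasIrreducibleModPGaloisRep_of_hasSurjectiveModNGaloisRep W 2 h2) f hf ϖ hϖ)
    (katoMuPartAtTwo_of_greenbergMu hG W hcm hr hgo h2 hΔ)

/-- **THE DIRECT ROAD BY NAME — `GreenbergMuZeroTwoOrdPosDisc` + Abbes–Ullmo + Kato 17.4 (1)(2) at `2` ⟹ the `0 < Δ` conjunct's body**
(`W′ := W`). This is the composition the v24 draft registers as `posDisc_of_stubs := posDisc_of_greenbergMu stub_greenbergMu_two_posDisc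
print_AU (kato1712_at_two_of_pub stub_pub)`; every door is LANDED. CONDITIONAL on G11⁺ (OPEN); nothing closed.
[cite: Kato2004Asterisque, Thm. 17.4 (1)(2) (p. 273)] [cite: AbbesUllmo1996, Thm. A] -/
theorem posDiscBody_of_greenbergMu (hG : GreenbergMuZeroTwoOrdPosDisc) (hAU : abbesUllmo_not_dvd_maninConstant_of_not_dvd_level)
    (h17 : ∀ (V : WeierstrassCurve ℚ) [V.IsElliptic] [V.IsGloballyMinimal] [NeZero (V.conductorNorm ℤ)]
      (f : CuspForm (Gamma0 (V.conductorNorm ℤ)) 2), kato_divisibility_allPrimes V 2 (f := f)) :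
    PosDiscBody :=
  fun W _ _ hcm hr hgo h2 hΔ =>
    ⟨W, ‹_›, ‹_›, isIsogenous_self W, mainConjectureLowerDivisibilityAtTwoOrd_of_greenbergMu hG hAU W hcm hr hgo h2 hΔ (h17 W)⟩

/-- The same fed from the ANNOUNCED TEXT (what a text-typed v24 stub hands the glue): one `Iff.rfl` away. [folklore] -/
theorem posDiscBody_of_leadList (hG : LeadList) (hAU : abbesUllmo_not_dvd_maninConstant_of_not_dvd_level)
    (h17 : ∀ (V : WeierstrassCurve ℚ) [V.IsElliptic] [V.IsGloballyMinimal] [NeZero (V.conductorNorm ℤ)]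
      (f : CuspForm (Gamma0 (V.conductorNorm ℤ)) 2), kato_divisibility_allPrimes V 2 (f := f)) :
    PosDiscBody :=
  posDiscBody_of_greenbergMu (leadList_iff_landed.mp hG) hAU h17

end Summit.BirchSwinnertonDyer.BirchSwinnertonDyer.Cruxes.OrdKatoHalfAtTwoIso.Cert51a

end
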